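import Mathlib
import Summits.Ventures.PercRepro2.Defs
import Summits.Ventures.PercRepro2.Independence
import Summits.Ventures.PercRepro2.Harris
import Summits.Ventures.PercRepro2.Graph
import Summits.Ventures.PercRepro2.Events
import Summits.Ventures.PercRepro2.ZCTwoEdge
import Summits.Ventures.PercRepro2.ZCLeafReductionsGraph
import Summits.Ventures.PercRepro2.ZCZeroWeight
import Summits.Ventures.PercRepro2.ZCLeafReductionsP
import Summits.Ventures.PercRepro2.ZCLeafReductionsP2

/-!
# (ZC) on every leaf-built graph — in particular on every finite tree
(blind cell PercRepro2, mine-a g23; MINE-A.md §70.6, the tree theorem in the kernel)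

An edge set is LEAF-BUILT when it can be listed as `[(f₁, z₁, ℓ₁), …, (f_n, z_n, ℓ_n)]` (strip order)
with `ends f_i = s(z_i, ℓ_i)`, `z_i ≠ ℓ_i`, and for `i < j`: `f_i ≠ f_j` and `ℓ_i ∉ ends f_j` — i.e.
`ℓ_i` is a leaf of `{f_i, …, f_n}`.  Every finite forest is leaf-built (strip leaves one at a time).
**Theorem** (`zc_of_leafBuilt`): if the weight vector `p` is supported on a leaf-built edge set,
then `(ZC)_p(a₁, a₃, o; 𝓔) ≥ 0` for ALL marks `a₁, a₃, o` (distinct or not) and every up-set `𝓔`.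
Proof: induction along the list, stripping the leaf `ℓ₁` by the matching `p`-leaf reduction
(`zc_leaf_nonmark_graph'`, `zc_leaf_o_graph'`, `zc_leaf_a3_graph'`, `zc_leaf_root_graph'` — the
reduced weight vector `p[f₁ ↦ 0]` is supported on the tail), the degenerate mark coincidences and
`{a₁} ∈ 𝓔` giving `(ZC) = 0`, and the all-closed base.  Consequently (ZC) holds on every finite
tree, every weight vector, every choice of marks, every cluster up-set; `zc_path` (every path) and
`zc_path_four` are explicit instances.  One seat.
-/

namespace Summit.Ventures.PercRepro2

section Degenerate

variable {V : Type*} {E : Type*} [Fintype E] [DecidableEq E] {R : Type*} [CommRing R]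

omit [Fintype E] [DecidableEq E] in
/-- `{x ↔ x}` is everything. -/
lemma connEvent_self (ends : E → Sym2 V) (x : V) : connEvent ends x x = Set.univ :=
  Set.eq_univ_of_forall fun ω => conn_refl ends ω x

/-- The (ZC) expression vanishes when two of the marks coincide. -/
lemma zc_eq_zero_of_coincide (p : E → R) (ends : E → Sym2 V) (a₁ a₃ o : V)
    (h : a₁ = a₃ ∨ a₁ = o ∨ a₃ = o) (𝓔 : Set (Set V)) :
    let e := connEvent ends a₁ a₃
    let L := connEvent ends a₁ o
    let U := clusterInEvent ends a₁ 𝓔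
    let γ := connEvent ends a₃ o
    prob p (eᶜ ∩ Lᶜ ∩ γᶜ) * (prob p (U ∩ (e ∩ L)) - prob p U * prob p (e ∩ L))
      - prob p (eᶜ ∩ Lᶜ ∩ γ) * (prob p (U ∩ (e ∩ Lᶜ)) - prob p U * prob p (e ∩ Lᶜ)) = 0 := by
  intro e L U γ
  rcases h with h | h | h
  · subst h
    have : e = Set.univ := connEvent_self ends a₁
    simp [this]
  · subst h
    have : L = Set.univ := connEvent_self ends a₁
    simp [this]
  · subst h
    have hγ : γ = Set.univ := connEvent_self ends a₃
    have heL : e = L := rfl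
    simp [hγ, heL]

/-- If `{a₁} ∈ 𝓔` (an up-set) then `U` is everything and the (ZC) expression vanishes. -/
lemma zc_eq_zero_of_singleton_mem (p : E → R) (ends : E → Sym2 V) (a₁ a₃ o : V)
    {𝓔 : Set (Set V)} (h𝓔 : IsUpperSet 𝓔) (h1 : ({a₁} : Set V) ∈ 𝓔) :
    let e := connEvent ends a₁ a₃
    let L := connEvent ends a₁ o
    let U := clusterInEvent ends a₁ 𝓔
    let γ := connEvent ends a₃ o
    prob p (eᶜ ∩ Lᶜ ∩ γᶜ) * (prob p (U ∩ (e ∩ L)) - prob p U * prob p (e ∩ L))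
      - prob p (eᶜ ∩ Lᶜ ∩ γ) * (prob p (U ∩ (e ∩ Lᶜ)) - prob p U * prob p (e ∩ Lᶜ)) = 0 := by
  intro e L U γ
  have hU : U = Set.univ := by
    apply Set.eq_univ_of_forall
    intro ω
    show cluster ends ω a₁ ∈ 𝓔
    exact h𝓔 (Set.singleton_subset_iff.2 (mem_cluster_self ends ω a₁)) h1
  simp [hU]

/-- With every weight `0` the configuration is a.s. all-closed and the (ZC) expression vanishes. -/
lemma zc_eq_zero_of_zero_weights (p : E → R) (hp : ∀ e, p e = 0) (ends : E → Sym2 V) (a₁ a₃ o : V)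
    (𝓔 : Set (Set V)) :
    let e := connEvent ends a₁ a₃
    let L := connEvent ends a₁ o
    let U := clusterInEvent ends a₁ 𝓔
    let γ := connEvent ends a₃ o
    prob p (eᶜ ∩ Lᶜ ∩ γᶜ) * (prob p (U ∩ (e ∩ L)) - prob p U * prob p (e ∩ L))
      - prob p (eᶜ ∩ Lᶜ ∩ γ) * (prob p (U ∩ (e ∩ Lᶜ)) - prob p U * prob p (e ∩ Lᶜ)) = 0 := by
  intro e L U γ
  classical
  -- every event has probability `1` or `0` according to the all-closed configuration
  have hc : ∀ ω : Config E, Finset.univ.piecewise (fun _ => false) ω = (fun _ => false) := by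
    intro ω; funext e'; exact Finset.piecewise_eq_of_mem _ _ _ (Finset.mem_univ e')
  have hpt : ∀ A : Set (Config E), prob p A = if (fun _ => false : Config E) ∈ A then 1 else 0 := by
    intro A
    rw [prob_eq_closeSet p Finset.univ (fun e _ => hp e) A]
    by_cases hA : (fun _ => false : Config E) ∈ A
    · have : {ω : Config E | Finset.univ.piecewise (fun _ => false) ω ∈ A} = Set.univ := by
        ext ω; simp [hc, hA]
      rw [this, if_pos hA, prob_univ]
    · have : {ω : Config E | Finset.univ.piecewise (fun _ => false) ω ∈ A} = ∅ := by
        ext ω; simp [hc, hA]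
      rw [this, if_neg hA, prob_empty]
  by_cases h1 : (fun _ => false : Config E) ∈ U <;>
    by_cases h2 : (fun _ => false : Config E) ∈ e <;>
    by_cases h3 : (fun _ => false : Config E) ∈ L <;>
    by_cases h4 : (fun _ => false : Config E) ∈ γ <;>
    simp [hpt, h1, h2, h3, h4]

end Degenerate

section Shifts

variable {V : Type*}

/-- The leaf shift of an up-set is an up-set. -/
lemma isUpperSet_leafShift {𝓔 : Set (Set V)} (h𝓔 : IsUpperSet 𝓔) (z v : V) :
    IsUpperSet {S : Set V | (z ∈ S ∧ insert v S ∈ 𝓔) ∨ (z ∉ S ∧ S ∈ 𝓔)} := by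
  intro S S' hSS' hS
  rcases hS with ⟨hzS, hS⟩ | ⟨hzS, hS⟩
  · exact Or.inl ⟨hSS' hzS, h𝓔 (Set.insert_subset_insert hSS') hS⟩
  · by_cases hz' : z ∈ S'
    · exact Or.inl ⟨hz', h𝓔 ((hSS'.trans (Set.subset_insert _ _))) hS⟩
    · exact Or.inr ⟨hz', h𝓔 hSS' hS⟩

/-- The root shift of an up-set is an up-set. -/
lemma isUpperSet_rootShift {𝓔 : Set (Set V)} (h𝓔 : IsUpperSet 𝓔) (a₁ : V) :
    IsUpperSet {S : Set V | insert a₁ S ∈ 𝓔} :=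
  fun _ _ hSS' hS => h𝓔 (Set.insert_subset_insert hSS') hS

end Shifts

section LeafBuilt

variable {V : Type*} [DecidableEq V] {E : Type*} [Fintype E] [DecidableEq E] {R : Type*}
  [CommRing R] [LinearOrder R] [IsStrictOrderedRing R]

/-- **(ZC) on every leaf-built graph.**  `L` lists edges in strip order with their leaf endpoints:
`ends t.1 = s(t.2.1, t.2.2)`, `t.2.1 ≠ t.2.2`, and earlier leaves are untouched by later edges
(`L.Pairwise (fun a b => a.1 ≠ b.1 ∧ a.2.2 ∉ ends b.1)`).  If `p` is supported on the listed edges,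
then (ZC) holds for every choice of marks and every up-set. -/
theorem zc_of_leafBuilt {ends : E → Sym2 V} (L : List (E × V × V))
    (hpair : L.Pairwise (fun a b => a.1 ≠ b.1 ∧ a.2.2 ∉ ends b.1))
    (hends : ∀ t ∈ L, ends t.1 = s(t.2.1, t.2.2) ∧ t.2.1 ≠ t.2.2) :
    ∀ (p : E → R), IsProbVec p → (∀ e, p e ≠ 0 → e ∈ L.map Prod.fst) →
    ∀ (a₁ a₃ o : V) (𝓔 : Set (Set V)), IsUpperSet 𝓔 →
    let e := connEvent ends a₁ a₃
    let L' := connEvent ends a₁ o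
    let U := clusterInEvent ends a₁ 𝓔
    let γ := connEvent ends a₃ o
    0 ≤ prob p (eᶜ ∩ L'ᶜ ∩ γᶜ) * (prob p (U ∩ (e ∩ L')) - prob p U * prob p (e ∩ L'))
      - prob p (eᶜ ∩ L'ᶜ ∩ γ) * (prob p (U ∩ (e ∩ L'ᶜ)) - prob p U * prob p (e ∩ L'ᶜ)) := by
  induction L with
  | nil =>
    intro p _ hsupp a₁ a₃ o 𝓔 _
    have hp0 : ∀ e, p e = 0 := by
      intro e
      by_contra h
      simpa using hsupp e h
    simp only
    rw [zc_eq_zero_of_zero_weights p hp0 ends a₁ a₃ o 𝓔]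
  | cons t L ih =>
    intro p hp hsupp a₁ a₃ o 𝓔 h𝓔
    obtain ⟨f, z, ℓ⟩ := t
    simp only
    have hpair' : L.Pairwise (fun a b => a.1 ≠ b.1 ∧ a.2.2 ∉ ends b.1) :=
      (List.pairwise_cons.1 hpair).2
    have hhead : ∀ b ∈ L, f ≠ b.1 ∧ ℓ ∉ ends b.1 := (List.pairwise_cons.1 hpair).1
    have hends' : ∀ t ∈ L, ends t.1 = s(t.2.1, t.2.2) ∧ t.2.1 ≠ t.2.2 :=
      fun t ht => hends t (List.mem_cons_of_mem _ ht)
    obtain ⟨hf, hzℓ⟩ := hends (f, z, ℓ) List.mem_cons_self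
    simp only at hf hzℓ
    -- `ℓ` is a `p`-leaf: every other edge at `ℓ` has weight `0`
    have hleaf : ∀ e, ℓ ∈ ends e → e = f ∨ p e = 0 := by
      intro e he
      by_cases hef : e = f
      · exact Or.inl hef
      · right
        by_contra hne
        have hmem := hsupp e hne
        simp only [List.map_cons, List.mem_cons] at hmem
        rcases hmem with h | h
        · exact hef h
        · obtain ⟨b, hb, rfl⟩ := List.mem_map.1 h
          exact (hhead b hb).2 he
    -- the reduced weight vector is supported on the tail
    have hp' : IsProbVec (Function.update p f 0) := hp.update f le_rfl zero_le_one
    have hsupp' : ∀ e, Function.update p f 0 e ≠ 0 → e ∈ L.map Prod.fst := by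
      intro e he
      by_cases hef : e = f
      · subst hef; simp at he
      · rw [Function.update_of_ne hef] at he
        have hmem := hsupp e he
        simp only [List.map_cons, List.mem_cons] at hmem
        rcases hmem with h | h
        · exact absurd h hef
        · exact h
    have ih' := ih hpair' hends' (Function.update p f 0) hp' hsupp'
    have hpf : 0 ≤ p f := hp.nonneg f
    -- the four cases: which mark (if any) is the leaf `ℓ`
    by_cases hcoin : a₁ = a₃ ∨ a₁ = o ∨ a₃ = o
    · have := zc_eq_zero_of_coincide p ends a₁ a₃ o hcoin 𝓔
      simp only at this
      rw [this]
    have h13 : a₁ ≠ a₃ := fun h => hcoin (Or.inl h)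
    have h1o : a₁ ≠ o := fun h => hcoin (Or.inr (Or.inl h))
    have h3o : a₃ ≠ o := fun h => hcoin (Or.inr (Or.inr h))
    by_cases hℓ1 : ℓ = a₁
    · subst hℓ1
      by_cases h1𝓔 : ({ℓ} : Set V) ∈ 𝓔
      · have := zc_eq_zero_of_singleton_mem p ends ℓ a₃ o h𝓔 h1𝓔
        simp only at this
        rw [this]
      · have hred := zc_leaf_root_graph' hp hf hleaf h13 h1o (Ne.symm hzℓ) h𝓔 h1𝓔
          (ih' z a₃ o _ (isUpperSet_rootShift h𝓔 ℓ))
        simp only at hred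
        refine le_trans ?_ hred
        exact mul_nonneg hpf (ih' z a₃ o _ (isUpperSet_rootShift h𝓔 ℓ))
    by_cases hℓ3 : ℓ = a₃
    · subst hℓ3
      have hred := zc_leaf_a3_graph' hp hf hleaf (Ne.symm h13) h3o (Ne.symm hzℓ) h𝓔
      simp only at hred
      refine le_trans ?_ hred
      exact mul_nonneg (mul_nonneg hpf hpf) (ih' a₁ z o _ (isUpperSet_leafShift h𝓔 z ℓ))
    by_cases hℓo : ℓ = o
    · subst hℓo
      have hred := zc_leaf_o_graph' hp hf hleaf (Ne.symm h1o) (Ne.symm h3o) (Ne.symm hzℓ) h𝓔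
      simp only at hred
      refine le_trans ?_ hred
      exact mul_nonneg hpf (ih' a₁ a₃ z _ (isUpperSet_leafShift h𝓔 z ℓ))
    · have hred := zc_leaf_nonmark_graph' p hf hleaf hℓ1 hℓ3 hℓo (Ne.symm hzℓ) 𝓔
      simp only at hred
      rw [hred]
      exact add_nonneg (mul_nonneg (sub_nonneg.2 (hp.le_one f)) (ih' a₁ a₃ o 𝓔 h𝓔))
        (mul_nonneg hpf (ih' a₁ a₃ o _ (isUpperSet_leafShift h𝓔 z ℓ)))

end LeafBuilt

section PathExample

/-- **(ZC) on the path `0 — 1 — 2 — 3`** (edges `0 = {0,1}`, `1 = {1,2}`, `2 = {2,3}`): every weight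
vector, every choice of the three marks, every up-set — `zc_of_leafBuilt` on the strip list
`[(2, 2, 3), (1, 1, 2), (0, 0, 1)]`. -/
theorem zc_path_four {R : Type*} [CommRing R] [LinearOrder R] [IsStrictOrderedRing R]
    {p : Fin 3 → R} (hp : IsProbVec p) (a₁ a₃ o : Fin 4) {𝓔 : Set (Set (Fin 4))}
    (h𝓔 : IsUpperSet 𝓔) :
    let ends : Fin 3 → Sym2 (Fin 4) := ![s(0, 1), s(1, 2), s(2, 3)]
    let e := connEvent ends a₁ a₃
    let L' := connEvent ends a₁ o
    let U := clusterInEvent ends a₁ 𝓔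
    let γ := connEvent ends a₃ o
    0 ≤ prob p (eᶜ ∩ L'ᶜ ∩ γᶜ) * (prob p (U ∩ (e ∩ L')) - prob p U * prob p (e ∩ L'))
      - prob p (eᶜ ∩ L'ᶜ ∩ γ) * (prob p (U ∩ (e ∩ L'ᶜ)) - prob p U * prob p (e ∩ L'ᶜ)) := by
  intro ends e L' U γ
  have hL := zc_of_leafBuilt (ends := ends) [((2 : Fin 3), (2 : Fin 4), (3 : Fin 4)), (1, 1, 2), (0, 0, 1)]
    (by simp [ends, List.pairwise_cons, Sym2.mem_iff])
    (by simp [ends])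
    p hp (by intro e _; fin_cases e <;> simp) a₁ a₃ o 𝓔 h𝓔
  simpa using hL

end PathExample

section PathN

/-- **(ZC) on every path**: vertices `Fin (n+1)`, edges `Fin n` with `ends i = s(i, i+1)`; every weight
vector, every choice of the three marks, every up-set. -/
theorem zc_path {R : Type*} [CommRing R] [LinearOrder R] [IsStrictOrderedRing R] (n : ℕ)
    {p : Fin n → R} (hp : IsProbVec p) (a₁ a₃ o : Fin (n + 1)) {𝓔 : Set (Set (Fin (n + 1)))}
    (h𝓔 : IsUpperSet 𝓔) :
    let ends : Fin n → Sym2 (Fin (n + 1)) := fun i => s(i.castSucc, i.succ)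
    let e := connEvent ends a₁ a₃
    let L' := connEvent ends a₁ o
    let U := clusterInEvent ends a₁ 𝓔
    let γ := connEvent ends a₃ o
    0 ≤ prob p (eᶜ ∩ L'ᶜ ∩ γᶜ) * (prob p (U ∩ (e ∩ L')) - prob p U * prob p (e ∩ L'))
      - prob p (eᶜ ∩ L'ᶜ ∩ γ) * (prob p (U ∩ (e ∩ L'ᶜ)) - prob p U * prob p (e ∩ L'ᶜ)) := by
  intro ends e L' U γ
  have hL := zc_of_leafBuilt (ends := ends)
    ((List.finRange n).reverse.map (fun i => (i, i.castSucc, i.succ)))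
    (by
      rw [List.pairwise_map, List.pairwise_reverse]
      refine (List.pairwise_lt_finRange n).imp ?_
      intro i j hij
      refine ⟨(Fin.ne_of_lt hij).symm, ?_⟩
      simp only [ends, Sym2.mem_iff, not_or]
      have hij' : i.val < j.val := hij
      constructor
      · intro h
        have := congrArg Fin.val h
        simp only [Fin.val_succ, Fin.val_castSucc] at this
        omega
      · intro h
        have := congrArg Fin.val h
        simp only [Fin.val_succ] at this
        omega)
    (by
      intro t ht
      simp only [List.mem_map, List.mem_reverse, List.mem_finRange, true_and] at ht
      obtain ⟨i, rfl⟩ := ht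
      exact ⟨rfl, Fin.castSucc_lt_succ.ne⟩)
    p hp
    (by
      intro e _
      simp only [List.map_map, List.mem_map, List.mem_reverse, List.mem_finRange, true_and]
      exact ⟨e, rfl⟩)
    a₁ a₃ o 𝓔 h𝓔
  simpa using hL

end PathN

end Summit.Ventures.PercRepro2
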